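import Summits.QuantumFields.BalabanUV.T4Continuum.Support.NE3CoarseTorusExact
import Summits.QuantumFields.BalabanUV.T4Continuum.Support.SkeletonLattice
import HarnessLib

/-!
# T⁴ programme, node NE3 — row E-MLw-(w4)-P, flat file F1: THE ADJOINT OF THE SHEARED BLOCK-LINE SUM IS A LONGITUDINAL
# LINEAR INTERPOLATION; its split into a quadratic-spline coboundary plus a FACE JUMP; the face jump of an exact coarse form
# is `M²·` a fine gauge mode, killed by the Landau condition

NE3 (node U1b), row NE3 OWNER `b2b-balaban-t4-ne3-p1` (gen 21), design ruling D-ne3p1-g21-1 (journal l.15420) §1 (I)–(V).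

WHY.  On the k-fold tangent space at the flat background the straight block-line average `S = (Qcoarse L)^[k] Y` is a
coarse COBOUNDARY `dPot μ` (leaf-04 `NE3TangentFlatStructure`), and leaf-04's block-Poincaré core (`NE3BlockPoincareCore`)
reduces the Poincaré inequality to a bound on `Σ‖S‖²`.  Route (C1) bounded it through the coarse torus Laplacian (factor `N²`,
and a small divisor at curved backgrounds with torus holonomy).  THIS FILE supplies the holonomy-robust replacement: the exact
ADJOINT of the unnormalised line sum `T z κ = Σ_{v∈[0,M)^d} Σ_{i<M} Y(M•z + v + i e_κ) κ` (`M = L^k`), written on the fine torus,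
is the longitudinal linear interpolation `Wad ω x κ = (r_κ(x)+1)•ω(z(x)) κ + (M−1−r_κ(x))•ω(z(x)−e_κ) κ` (`z = cdiv M`,
`r = cmod M`); it SPLITS as `∂_κ(hsp ω) + Jmp ω` with a quadratic-spline correction `hsp` of size `≤ M²∕2·|ω|` and a face jump
`Jmp ω = [r_κ = M−1]·M²•ω(z)`; and for an EXACT `ω = dPot μ` the face jump is `M²•dPot (μ ∘ cdiv M)` — a fine gauge mode — so it
pairs to ZERO against every flat-divergence-free `Y`.  The frame potential `μ` is never estimated.  (File F2
`NE3BlockPoincareLandau` turns this into the N-FREE S-bound and the N-free Poincaré inequality on `ker Tcoarse^[k] ∩ Landau`.)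

CONTENT ([folklore]; 0 sorry; data defs `tbase` (split multi-index) and `Wad` — explicit weights over
`SkeletonLattice.cdiv∕cmod`; no `def … : Prop`):
§1 the 1D identity `Σ_{r<M}Σ_{i<M} y(r+i) = Σ_{s<M}(s+1)•y s + Σ_{t<M}(M−1−t)•y(M+t)` and its block form
   **`sum_box_lineSum_eq`**: `Σ_{v∈[0,M)^d}Σ_{i<M} F(v + i e_κ) = Σ_v ((v κ)+1)•F v + Σ_v (M−1−v κ)•F(v + M e_κ)`;
§2 residues one step on (`cdiv`∕`cmod` of `x + e_κ`), periodicity of the residue data;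
§3 **`sum_inner_lineSum_eq_sum_inner_Wad`** (torus adjoint identity);
(companion file `NE3StraightAverageSplit`: the split `Wad = ∂_κ hsp + Jmp`, `‖hsp‖ ≤ M²∕2·(…)`, periodic summation by parts,
`Jmp (dPot μ) = M²•dPot (μ ∘ cdiv M)` and its vanishing pairing with flat-divergence-free fields).

HONEST FRAMING.  Lattice combinatorics of OUR frame at the FLAT configuration; nothing about Bałaban's minimisers, (P_W),
(ML_w), T-E_w or NE3 is asserted; NE3 NOT proved; spine PROVED 0∕9; finite T⁴ rung (B)+1 — NOT infinite volume, NOT mass gap,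
NOT BetaPertH, NOT Clay.  ABSOLUTE RULE kept (nothing printed is a hypothesis; context only: [Balaban1985Averaging] (122)∕(125)
p. 36, the straight average `L·Q₀`).  PLACEMENT: `Summits/QuantumFields/BalabanUV/`; imports leaf-04's accepted
`NE3CoarseTorusExact` (for `NE3BlockLineAverage` + the periodic shift) and the accepted `SkeletonLattice` BY NAME.
-/

set_option autoImplicit false

open scoped BigOperators InnerProductSpace
open Finset

namespace Summit.QuantumFields.BalabanUV.T4Continuum.NE3StraightAverageAdjoint

open Literature.MathematicalPhysics.QuantumFieldTheory.Balaban1983to89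
open B7Prop1Explicit
open T4AveragingDeficitWallBoundary (periodBox mem_periodBox)
open NE3TangentNoGoWords (dPot)
open NE3BlockLineAverage (sum_univ_boxVec sum_periodBox_blocks)
open NE3CoarseTorusExact (sum_periodBox_add_e)
open SkeletonLattice (cdiv cmod smul_cdiv_add_cmod cmod_nonneg cmod_lt cdiv_eq_of_repr cmod_eq_of_repr cdiv_add_period
  cmod_add_period)

noncomputable section

variable {d : ℕ}

/-! ## §1 The one-dimensional identity and its block form -/

/-- `Σ_{r<M} Σ_{i<M} y(r+i) = Σ_{s<M} (s+1)•y s + Σ_{t<M} (M−1−t)•y(M+t)` — the fibre count of `(r,i) ↦ r+i`. [folklore] -/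
theorem sum_range_sum_range_add {β : Type*} [AddCommMonoid β] (M : ℕ) (y : ℕ → β) :
    ∑ r ∈ range M, ∑ i ∈ range M, y (r + i)
      = ∑ s ∈ range M, (s + 1) • y s + ∑ t ∈ range M, (M - 1 - t) • y (M + t) := by
  have hsplit : ∀ r ∈ range M,
      ∑ i ∈ range M, y (r + i) = ∑ s ∈ Ico r M, y s + ∑ t ∈ Ico 0 r, y (M + t) := by
    intro r hr
    rw [mem_range] at hr
    rw [range_eq_Ico, ← sum_Ico_consecutive _ (Nat.zero_le (M - r)) (Nat.sub_le M r)]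
    congr 1
    · have h : Ico r M = (Ico 0 (M - r)).map (addLeftEmbedding r) := by
        rw [map_add_left_Ico, Nat.add_zero, Nat.add_sub_cancel' hr.le]
      rw [h, sum_map]
      rfl
    · have h : Ico (M - r) M = (Ico 0 r).map (addLeftEmbedding (M - r)) := by
        rw [map_add_left_Ico, Nat.add_zero, Nat.sub_add_cancel hr.le]
      rw [h, sum_map]
      refine sum_congr rfl fun t _ => ?_
      simp only [addLeftEmbedding_apply]
      congr 1; omega
  rw [sum_congr rfl hsplit, sum_add_distrib]
  congr 1
  · rw [range_eq_Ico, sum_Ico_Ico_comm]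
    refine sum_congr rfl fun s _ => ?_
    rw [sum_const, Nat.card_Ico, Nat.sub_zero]
  · rw [range_eq_Ico, ← sum_Ico_Ico_comm']
    refine sum_congr rfl fun t ht => ?_
    rw [sum_const, Nat.card_Ico]
    congr 1; omega

variable {V : Type*} [AddCommGroup V] [Module ℝ V]

/-- The transverse part of a split multi-index, as a lattice vector with vanishing `κ`-coordinate. [folklore] -/
def tbase (κ : Fin d) {M : ℕ} (r' : {j : Fin d // j ≠ κ} → Fin M) : Site d :=
  fun j => if h : j = κ then 0 else ((r' ⟨j, h⟩ : ℕ) : ℤ)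

omit [AddCommGroup V] [Module ℝ V] in
/-- `boxVec` of a split multi-index: transverse part plus `a•e_κ`. [folklore] -/
theorem boxVec_funSplitAt_symm (κ : Fin d) {M : ℕ} (a : Fin M) (r' : {j : Fin d // j ≠ κ} → Fin M) :
    boxVec M ((Equiv.funSplitAt κ (Fin M)).symm (a, r')) = tbase κ r' + ((a : ℕ) : ℤ) • e κ := by
  funext j
  simp only [boxVec, tbase, Pi.add_apply, Pi.smul_apply, e_apply, smul_eq_mul]
  by_cases hj : j = κ
  · subst hj
    simp [Equiv.funSplitAt, Equiv.piSplitAt]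
  · simp [Equiv.funSplitAt, Equiv.piSplitAt, hj]

omit [AddCommGroup V] [Module ℝ V] in
/-- The `κ`-coordinate of `boxVec` of a split multi-index is the split-off index. [folklore] -/
theorem boxVec_funSplitAt_symm_apply (κ : Fin d) {M : ℕ} (a : Fin M) (r' : {j : Fin d // j ≠ κ} → Fin M) :
    boxVec M ((Equiv.funSplitAt κ (Fin M)).symm (a, r')) κ = ((a : ℕ) : ℤ) := by
  rw [boxVec_funSplitAt_symm]
  simp [tbase, e_apply]

/-- **THE BLOCK FORM OF THE FIBRE COUNT** (any `M`, any direction, any vector-valued `F`):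
`Σ_{v∈[0,M)^d} Σ_{i<M} F(v + i e_κ) = Σ_v ((v κ)+1)•F v + Σ_v (M−1−(v κ))•F(v + M e_κ)` (real weights). [folklore] -/
theorem sum_box_lineSum_eq (M : ℕ) (κ : Fin d) (F : Site d → V) :
    ∑ v ∈ periodBox (d := d) M, ∑ i ∈ range M, F (v + (i : ℤ) • e κ)
      = ∑ v ∈ periodBox (d := d) M, (((v κ : ℤ) : ℝ) + 1) • F v
        + ∑ v ∈ periodBox (d := d) M, ((M : ℝ) - 1 - ((v κ : ℤ) : ℝ)) • F (v + (M : ℤ) • e κ) := by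
  set Φ := Equiv.funSplitAt κ (Fin M) with hΦ
  -- every box sum through the split chart
  have hre : ∀ G : Site d → V, ∑ v ∈ periodBox (d := d) M, G v
      = ∑ r' : {j : Fin d // j ≠ κ} → Fin M, ∑ a : Fin M, G (tbase κ r' + ((a : ℕ) : ℤ) • e κ) := by
    intro G
    rw [← sum_univ_boxVec, Fintype.sum_equiv Φ (fun r => G (boxVec M r)) (fun p => G (boxVec M (Φ.symm p)))
      (fun r => by simp only [Equiv.symm_apply_apply]), Fintype.sum_prod_type, sum_comm]
    refine Fintype.sum_congr _ _ fun r' => Fintype.sum_congr _ _ fun a => ?_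
    rw [boxVec_funSplitAt_symm]
  rw [hre, hre, hre, ← sum_add_distrib]
  refine Fintype.sum_congr _ _ fun r' => ?_
  -- the κ-coordinate of the split point
  have hκ : ∀ a : Fin M, (tbase κ r' + ((a : ℕ) : ℤ) • e κ) κ = ((a : ℕ) : ℤ) := by
    intro a; simp [tbase, Pi.add_apply, e_apply]
  simp only [hκ, Int.cast_natCast]
  -- to `range M` sums and the 1D identity
  have h1 := sum_range_sum_range_add M (fun s => F (tbase κ r' + (s : ℤ) • e κ))
  rw [Fin.sum_univ_eq_sum_range (fun a => ∑ i ∈ range M, F (tbase κ r' + ((a : ℕ) : ℤ) • e κ + (i : ℤ) • e κ)) M,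
    Fin.sum_univ_eq_sum_range (fun a => (((a : ℕ) : ℝ) + 1) • F (tbase κ r' + ((a : ℕ) : ℤ) • e κ)) M,
    Fin.sum_univ_eq_sum_range (fun a => ((M : ℝ) - 1 - ((a : ℕ) : ℝ)) • F (tbase κ r' + ((a : ℕ) : ℤ) • e κ
      + (M : ℤ) • e κ)) M]
  have hlhs : ∑ a ∈ range M, ∑ i ∈ range M, F (tbase κ r' + ((a : ℕ) : ℤ) • e κ + (i : ℤ) • e κ)
      = ∑ a ∈ range M, ∑ i ∈ range M, F (tbase κ r' + ((a + i : ℕ) : ℤ) • e κ) := by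
    refine sum_congr rfl fun a _ => sum_congr rfl fun i _ => ?_
    congr 1; push_cast; rw [add_smul, add_assoc]
  rw [hlhs, h1]
  congr 1
  · refine sum_congr rfl fun s _ => ?_
    rw [← Nat.cast_smul_eq_nsmul ℝ]; push_cast; rfl
  · refine sum_congr rfl fun t ht => ?_
    rw [mem_range] at ht
    rw [← Nat.cast_smul_eq_nsmul ℝ, Nat.cast_sub (by omega), Nat.cast_sub (by omega)]
    congr 1
    · push_cast; ring
    · push_cast; rw [add_assoc, ← add_smul, add_comm (t : ℤ)]

/-! ## §2 Residues under one lattice step; periodicity -/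

section Residues

variable {M : ℕ}

omit [AddCommGroup V] [Module ℝ V] in
/-- Across a NON-face bond the block index does not change: `cdiv M (x + e_κ) = cdiv M x` if `cmod M x κ ≠ M − 1`.
(leaf-01-g4 `NE3SpreadLiftCurlLocal.cdiv_add_e_of_not_isCross`, restated over `cmod`.) [folklore] -/
theorem cdiv_add_e_of_ne (hM : 1 ≤ M) {x : Site d} {κ : Fin d} (h : cmod M x κ ≠ (M : ℤ) - 1) :
    cdiv M (x + e κ) = cdiv M x := by
  have hr0 := cmod_nonneg (L := M) hM x
  have hrL := cmod_lt (L := M) hM x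
  refine cdiv_eq_of_repr (L := M) (q := cmod M x + e κ) ?_ (fun i => ?_) (fun i => ?_)
  · rw [← add_assoc, smul_cdiv_add_cmod]
  · have := hr0 i; simp only [Pi.add_apply, e_apply]; split_ifs <;> linarith
  · by_cases hi : i = κ
    · subst hi; have h1 := hrL i; simp only [Pi.add_apply, e_apply, if_true]; omega
    · have h1 := hrL i; simp only [Pi.add_apply, e_apply, if_neg hi]; linarith

omit [AddCommGroup V] [Module ℝ V] in
/-- … and the `κ`-residue advances by one. [folklore] -/
theorem cmod_add_e_of_ne (hM : 1 ≤ M) {x : Site d} {κ : Fin d} (h : cmod M x κ ≠ (M : ℤ) - 1) :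
    cmod M (x + e κ) = cmod M x + e κ := by
  have hr0 := cmod_nonneg (L := M) hM x
  have hrL := cmod_lt (L := M) hM x
  refine cmod_eq_of_repr (L := M) (z := cdiv M x) ?_ (fun i => ?_) (fun i => ?_)
  · rw [← add_assoc, smul_cdiv_add_cmod]
  · have := hr0 i; simp only [Pi.add_apply, e_apply]; split_ifs <;> linarith
  · by_cases hi : i = κ
    · subst hi; have h1 := hrL i; simp only [Pi.add_apply, e_apply, if_true]; omega
    · have h1 := hrL i; simp only [Pi.add_apply, e_apply, if_neg hi]; linarith

omit [AddCommGroup V] [Module ℝ V] in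
/-- Across a FACE bond the block index advances: `cdiv M (x + e_κ) = cdiv M x + e_κ` if `cmod M x κ = M − 1`. [folklore] -/
theorem cdiv_add_e_of_eq (hM : 1 ≤ M) {x : Site d} {κ : Fin d} (h : cmod M x κ = (M : ℤ) - 1) :
    cdiv M (x + e κ) = cdiv M x + e κ := by
  have hr0 := cmod_nonneg (L := M) hM x
  have hrL := cmod_lt (L := M) hM x
  refine cdiv_eq_of_repr (L := M) (q := cmod M x + e κ - (M : ℤ) • e κ) ?_ (fun i => ?_) (fun i => ?_)
  · conv_lhs => rw [← smul_cdiv_add_cmod M x]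
    rw [smul_add]
    abel
  · by_cases hi : i = κ
    · subst hi; simp only [Pi.add_apply, Pi.sub_apply, Pi.smul_apply, e_apply, if_true, smul_eq_mul, mul_one]; omega
    · have := hr0 i; simp only [Pi.add_apply, Pi.sub_apply, Pi.smul_apply, e_apply, if_neg hi, smul_eq_mul]; linarith
  · by_cases hi : i = κ
    · subst hi; simp only [Pi.add_apply, Pi.sub_apply, Pi.smul_apply, e_apply, if_true, smul_eq_mul, mul_one]; omega
    · have := hrL i; simp only [Pi.add_apply, Pi.sub_apply, Pi.smul_apply, e_apply, if_neg hi, smul_eq_mul]; linarith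

omit [AddCommGroup V] [Module ℝ V] in
/-- … and the `κ`-residue wraps to `0`. [folklore] -/
theorem cmod_add_e_of_eq (hM : 1 ≤ M) {x : Site d} {κ : Fin d} (h : cmod M x κ = (M : ℤ) - 1) :
    cmod M (x + e κ) = cmod M x + e κ - (M : ℤ) • e κ := by
  have hr0 := cmod_nonneg (L := M) hM x
  have hrL := cmod_lt (L := M) hM x
  refine cmod_eq_of_repr (L := M) (z := cdiv M x + e κ) ?_ (fun i => ?_) (fun i => ?_)
  · conv_lhs => rw [← smul_cdiv_add_cmod M x]
    rw [smul_add]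
    abel
  · by_cases hi : i = κ
    · subst hi; simp only [Pi.add_apply, Pi.sub_apply, Pi.smul_apply, e_apply, if_true, smul_eq_mul, mul_one]; omega
    · have := hr0 i; simp only [Pi.add_apply, Pi.sub_apply, Pi.smul_apply, e_apply, if_neg hi, smul_eq_mul]; linarith
  · by_cases hi : i = κ
    · subst hi; simp only [Pi.add_apply, Pi.sub_apply, Pi.smul_apply, e_apply, if_true, smul_eq_mul, mul_one]; omega
    · have := hrL i; simp only [Pi.add_apply, Pi.sub_apply, Pi.smul_apply, e_apply, if_neg hi, smul_eq_mul]; linarith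

omit [AddCommGroup V] [Module ℝ V] in
/-- Residues of a block point: `cdiv M (M•z + v) = z`, `cmod M (M•z + v) = v` for `v ∈ [0,M)^d`. [folklore] -/
theorem cdiv_cmod_block {z v : Site d} (hv : v ∈ periodBox (d := d) M) :
    cdiv M ((M : ℤ) • z + v) = z ∧ cmod M ((M : ℤ) • z + v) = v := by
  rw [mem_periodBox] at hv
  exact ⟨cdiv_eq_of_repr (L := M) rfl (fun i => (hv i).1) (fun i => (hv i).2),
    cmod_eq_of_repr (L := M) rfl (fun i => (hv i).1) (fun i => (hv i).2)⟩

end Residues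

/-! ## §3 The adjoint weights and the torus adjoint identity -/

/-- **THE ADJOINT OF THE SHEARED BLOCK-LINE SUM** read on the fine lattice: the LONGITUDINAL LINEAR INTERPOLATION of the coarse
1-form `ω`, `Wad M ω x κ := (r_κ(x) + 1)•ω(z(x)) κ + (M − 1 − r_κ(x))•ω(z(x) − e_κ) κ` (`z = cdiv M`, `r = cmod M`). [folklore] -/
def Wad (M : ℕ) (ω : Site d → Fin d → V) (x : Site d) (κ : Fin d) : V :=
  (((cmod M x κ : ℤ) : ℝ) + 1) • ω (cdiv M x) κ + ((M : ℝ) - 1 - ((cmod M x κ : ℤ) : ℝ)) • ω (cdiv M x - e κ) κ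

/-- `Wad` at a block point. [folklore] -/
theorem Wad_block (M : ℕ) (ω : Site d → Fin d → V) {z v : Site d} (hv : v ∈ periodBox (d := d) M) (κ : Fin d) :
    Wad M ω ((M : ℤ) • z + v) κ = (((v κ : ℤ) : ℝ) + 1) • ω z κ + ((M : ℝ) - 1 - ((v κ : ℤ) : ℝ)) • ω (z - e κ) κ := by
  obtain ⟨h1, h2⟩ := cdiv_cmod_block (M := M) (z := z) hv
  simp only [Wad, h1, h2]

/-- `Wad` of an `N`-periodic coarse form is `M·N`-periodic. [folklore] -/
theorem Wad_periodic {M : ℕ} (hM : 1 ≤ M) {N : ℕ} (ω : Site d → Fin d → V)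
    (hω : ∀ (z : Site d) (τ μ : Fin d), ω (z + (N : ℤ) • e τ) μ = ω z μ) (x : Site d) (τ κ : Fin d) :
    Wad M ω (x + ((M * N : ℕ) : ℤ) • e τ) κ = Wad M ω x κ := by
  have hc := cdiv_add_period (L := M) hM (N : ℤ) x τ
  have hm := cmod_add_period (L := M) (N : ℤ) x τ
  push_cast at hc hm ⊢
  simp only [Wad, hc, hm]
  rw [hω, add_sub_right_comm, hω]

variable {E : Type*} [NormedAddCommGroup E] [InnerProductSpace ℝ E]

/-- **THE TORUS ADJOINT IDENTITY** (one direction `κ`): for an `N`-periodic coarse form `ω` and an `M·N`-periodic fine field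
`Y`, `Σ_{z∈periodBox N} ⟪ω z κ, Σ_{v∈[0,M)^d} Σ_{i<M} Y(M•z + v + i e_κ) κ⟫ = Σ_{x∈periodBox (M·N)} ⟪Wad M ω x κ, Y x κ⟫`.
[folklore] -/
theorem sum_inner_lineSum_eq_sum_inner_Wad {M : ℕ} (hM : 1 ≤ M) {N : ℕ} (hN : 1 ≤ N) (κ : Fin d)
    (ω : Site d → Fin d → E) (Y : Site d → Fin d → E)
    (hω : ∀ (z : Site d) (τ μ : Fin d), ω (z + (N : ℤ) • e τ) μ = ω z μ)
    (hY : ∀ (x : Site d) (τ μ : Fin d), Y (x + ((M * N : ℕ) : ℤ) • e τ) μ = Y x μ) :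
    ∑ z ∈ periodBox (d := d) N,
        ⟪ω z κ, ∑ v ∈ periodBox (d := d) M, ∑ i ∈ range M, Y ((M : ℤ) • z + v + (i : ℤ) • e κ) κ⟫_ℝ
      = ∑ x ∈ periodBox (d := d) (M * N), ⟪Wad M ω x κ, Y x κ⟫_ℝ := by
  -- the fine sum block by block, with the explicit weights
  rw [← sum_periodBox_blocks M N hM (fun x => ⟪Wad M ω x κ, Y x κ⟫_ℝ)]
  have hblk : ∀ z ∈ periodBox (d := d) N, ∑ v ∈ periodBox (d := d) M, ⟪Wad M ω ((M : ℤ) • z + v) κ, Y ((M : ℤ) • z + v) κ⟫_ℝ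
      = ⟪ω z κ, ∑ v ∈ periodBox (d := d) M, (((v κ : ℤ) : ℝ) + 1) • Y ((M : ℤ) • z + v) κ⟫_ℝ
        + ⟪ω (z - e κ) κ, ∑ v ∈ periodBox (d := d) M, ((M : ℝ) - 1 - ((v κ : ℤ) : ℝ)) • Y ((M : ℤ) • z + v) κ⟫_ℝ := by
    intro z _
    rw [inner_sum, inner_sum, ← sum_add_distrib]
    refine sum_congr rfl fun v hv => ?_
    rw [Wad_block M ω hv, inner_add_left, real_inner_smul_left, real_inner_smul_left, real_inner_smul_right,
      real_inner_smul_right]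
  rw [sum_congr rfl hblk, sum_add_distrib]
  -- shift the second sum: z ↦ z + e κ
  have hshift : ∑ z ∈ periodBox (d := d) N,
      ⟪ω (z - e κ) κ, ∑ v ∈ periodBox (d := d) M, ((M : ℝ) - 1 - ((v κ : ℤ) : ℝ)) • Y ((M : ℤ) • z + v) κ⟫_ℝ
      = ∑ z ∈ periodBox (d := d) N,
      ⟪ω z κ, ∑ v ∈ periodBox (d := d) M, ((M : ℝ) - 1 - ((v κ : ℤ) : ℝ)) • Y ((M : ℤ) • z + v + (M : ℤ) • e κ) κ⟫_ℝ := by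
    have hper : ∀ (z : Site d) (τ : Fin d),
        ⟪ω (z + (N : ℤ) • e τ - e κ) κ,
          ∑ v ∈ periodBox (d := d) M, ((M : ℝ) - 1 - ((v κ : ℤ) : ℝ)) • Y ((M : ℤ) • (z + (N : ℤ) • e τ) + v) κ⟫_ℝ
        = ⟪ω (z - e κ) κ, ∑ v ∈ periodBox (d := d) M, ((M : ℝ) - 1 - ((v κ : ℤ) : ℝ)) • Y ((M : ℤ) • z + v) κ⟫_ℝ := by
      intro z τ
      rw [add_sub_right_comm, hω]
      congr 1
      refine sum_congr rfl fun v _ => ?_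
      congr 1
      have : (M : ℤ) • (z + (N : ℤ) • e τ) + v = (M : ℤ) • z + v + ((M * N : ℕ) : ℤ) • e τ := by
        push_cast; rw [smul_add, smul_smul]; abel
      rw [this, hY]
    have h := sum_periodBox_add_e hN
      (g := fun z => ⟪ω (z - e κ) κ,
        ∑ v ∈ periodBox (d := d) M, ((M : ℝ) - 1 - ((v κ : ℤ) : ℝ)) • Y ((M : ℤ) • z + v) κ⟫_ℝ) hper κ
    rw [← h]
    refine sum_congr rfl fun z _ => ?_
    simp only [add_sub_cancel_right]
    congr 1
    refine sum_congr rfl fun v _ => ?_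
    rw [smul_add]; congr 2; abel
  rw [hshift, ← sum_add_distrib]
  refine sum_congr rfl fun z _ => ?_
  rw [← inner_add_right]
  congr 1
  -- the block identity of §1 for `F w := Y (M•z + w) κ`
  have h := sum_box_lineSum_eq M κ (fun w => Y ((M : ℤ) • z + w) κ)
  rw [show ∑ v ∈ periodBox (d := d) M, ∑ i ∈ range M, Y ((M : ℤ) • z + v + (i : ℤ) • e κ) κ
      = ∑ v ∈ periodBox (d := d) M, ∑ i ∈ range M, Y ((M : ℤ) • z + (v + (i : ℤ) • e κ)) κ from
    sum_congr rfl fun v _ => sum_congr rfl fun i _ => by rw [add_assoc], h]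
  congr 1
  refine sum_congr rfl fun v _ => ?_
  rw [add_assoc]

end

end Summit.QuantumFields.BalabanUV.T4Continuum.NE3StraightAverageAdjoint
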